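import Literature.NumberTheory.Automorphic.AutomorphicSpectrumCompactQuotient
import Literature.NumberTheory.Automorphic.FiniteMultiplicityCriterion
import Literature.NumberTheory.Automorphic.QuaternionAlgebraAdelicMeasureProofs
import HarnessLib

/-!
# The spectrum of `L²(D_𝔸ˣ ⧸ ℝ_{>0} Dˣ)` is discrete with finite multiplicities
(Gelfand–Graev–Piatetski-Shapiro (1969), Ch. 1 §2; Deitmar–Echterhoff (2014), Thm. 9.2.2;
Gelbart, *Automorphic forms on adele groups* (1975), §10, (10.13)–(10.14))

Topic `NumberTheory/Automorphic`; theorems only. The starting point of the spectral side of the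
trace formula for the multiplicative group of a **division** quaternion algebra `D` over a number
field `K` (Gelbart (1975), §10: "`L²(G_ℚ Z_∞⁺ \ G_𝔸)` decomposes discretely with finite
multiplicities `m(π)`", the quotient being compact): honest `D^×` instances of the abstract
Gelfand–Graev–Piatetski-Shapiro theorems of the tree.

* `ContRepresentation.comp_integratedOperator_eq_integratedOperator_comp` — **integrated
  operators commute with the commutant**: if `U` commutes with every `π(g)` then
  `U ∘ π(f) = π(f) ∘ U` (Bochner integrals commute with bounded operators); the hypothesis
  "commutes with the commutant" of `FiniteMultiplicityCriterion`, for the abstract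
  `ContRepresentation.integratedOperator` (the tree had it only for `smoothedVectorL` of `GL_n`);
* `AdelicGroupData.units_locallyCompactSpace_secondCountableTopology` — `D_𝔸ˣ` is locally compact
  and second countable, keyed on the datum `AdelicGroupData.units K D`;
* `AdelicGroupData.isDiscretelyDecomposable_rightRegular_units`,
  `AdelicGroupData.discreteSpectrum_eq_top_units` — **`L²(D_𝔸ˣ ⧸ ℝ_{>0} Dˣ)` is the closed span of
  its irreducible closed invariant subspaces** (`isDiscretelyDecomposable_rightRegular_of_locallyCompactSpace`
  with Fujisaki's compactness `compactSpace_automorphicQuotient_units_holds`);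
* `AdelicGroupData.multiplicity_lt_top_units` — **every non-zero closed subrepresentation of
  `L²(D_𝔸ˣ ⧸ ℝ_{>0} Dˣ)` has finite multiplicity** (`IsUnitary.multiplicity_lt_top_of_isCompactOperator`
  with the compact operators `R(f)`, `isCompactOperator_integratedOperator_rightRegular`, their
  commutation with the commutant, and Dirac functions).

Part of the inline (D-0026) decomposition of
`Literature.NumberTheory.Automorphic.strong_multiplicity_one_quaternionUnits`.

## References

* I. M. Gelfand, M. I. Graev, I. I. Piatetski-Shapiro, *Representation theory and automorphic
  functions* (1969), Ch. 1 §2 [GelfandGraevPiatetskiShapiro1969].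
* A. Deitmar, S. Echterhoff, *Principles of Harmonic Analysis*, 2nd ed. (2014), Thm. 9.2.2,
  Lemma 9.2.7 [DeitmarEchterhoff2014].
* S. Gelbart, *Automorphic forms on adele groups* (1975), §10, (10.13)–(10.14) [Gelbart1975].
-/

noncomputable section

open NumberField IsDedekindDomain MeasureTheory Measure Set Filter Topology CompactlySupported
open scoped ENNReal

/-! ### Integrated operators commute with the commutant -/

namespace ContRepresentation

variable {G H : Type*} [Group G] [TopologicalSpace G] [MeasurableSpace G] [OpensMeasurableSpace G]
  [NormedAddCommGroup H] [InnerProductSpace ℂ H] [CompleteSpace H] (π : ContRepresentation ℂ G H)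

/-- **Integrated operators commute with the commutant of the representation**: if a bounded
operator `U` commutes with every `π(g)` then `U ∘ π(f) = π(f) ∘ U` for every `f ∈ C_c(G)`
(`π(f) v = ∫ f(g) • π(g) v dη`, and Bochner integrals commute with bounded operators, Mathlib
`ContinuousLinearMap.integral_comp_comm`; Deitmar–Echterhoff (2014), proof of Lemma 9.2.7).
[folklore] -/
theorem comp_integratedOperator_eq_integratedOperator_comp (hu : π.IsUnitary)
    (hc : π.IsStronglyContinuous) (η : Measure G) [IsFiniteMeasureOnCompacts η] (f : C_c(G, ℂ))
    (U : H →L[ℂ] H) (hU : ∀ g : G, U ∘L π g = π g ∘L U) :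
    U ∘L π.integratedOperator hu hc η f = π.integratedOperator hu hc η f ∘L U := by
  ext v
  rw [ContinuousLinearMap.comp_apply, ContinuousLinearMap.comp_apply, integratedOperator_apply,
    integratedOperator_apply, ← ContinuousLinearMap.integral_comp_comm U (integrable_smul_apply hc η f v)]
  refine integral_congr_ae (Eventually.of_forall fun g => ?_)
  change U (f g • π g v) = f g • π g (U v)
  rw [ContinuousLinearMap.map_smul]
  congr 1
  exact congrArg (fun T : H →L[ℂ] H => T v) (hU g)

end ContRepresentation

namespace Literature.NumberTheory.Automorphic

universe u

variable (K : Type) [Field K] [NumberField K] (D : Type u) [Ring D] [Algebra K D]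

/-- **`D_𝔸ˣ` is locally compact and second countable**, keyed on the datum
`AdelicGroupData.units K D` (units of the locally compact second countable ring `D ⊗ 𝔸_K ≅ 𝔸_K⁴`;
cf. `JacquetLanglandsMultiplicityOneProofs`). [folklore] -/
theorem AdelicGroupData.units_locallyCompactSpace_secondCountableTopology [Module.Finite K D] :
    LocallyCompactSpace (AdelicGroupData.units K D).Adelic ∧
      SecondCountableTopology (AdelicGroupData.units K D).Adelic := by
  haveI : LocallyCompactSpace (AdeleRing (𝓞 K) K) := locallyCompactSpace_adeleRing' K
  haveI : T2Space (AdeleRing (𝓞 K) K) := t2Space_adeleRing K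
  haveI i₁ : LocallyCompactSpace (adelicUnits K D) := inferInstance
  haveI i₃ : SecondCountableTopology (adelicUnits K D) := by
    haveI : SecondCountableTopology (AdeleRing (𝓞 K) K) := secondCountableTopology_adeleRing K
    haveI : SecondCountableTopology (ScalarExtension K (AdeleRing (𝓞 K) K) D) :=
      (ScalarExtension.coordHomeomorph K (AdeleRing (𝓞 K) K) D).secondCountableTopology
    haveI : SecondCountableTopology (ScalarExtension K (AdeleRing (𝓞 K) K) D)ᵐᵒᵖ :=
      MulOpposite.opHomeomorph.symm.secondCountableTopology
    exact Units.isEmbedding_embedProduct.secondCountableTopology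
  exact ⟨i₁, i₃⟩

variable [IsQuaternionAlgebra K D]

/-- **Gelfand–Graev–Piatetski-Shapiro for `D^×`**: for a division quaternion algebra `D` and an
automorphic measure `μ` on the compact quotient `D_𝔸ˣ ⧸ ℝ_{>0} Dˣ` (Fujisaki), the regular
representation on `L²` is discretely decomposable — `L²` is the closed span of its irreducible
closed invariant subspaces (Gelbart (1975), §10: the spectrum of `L²(G_ℚ Z_∞⁺ \\ G_𝔸)` is discrete;
Deitmar–Echterhoff Thm. 9.2.2). [cite: DeitmarEchterhoff2014, Thm. 9.2.2] -/
theorem AdelicGroupData.isDiscretelyDecomposable_rightRegular_units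
    (hdiv : ∀ x : D, x ≠ 0 → IsUnit x) (μ : Measure (AdelicGroupData.units K D).automorphicQuotient)
    [(AdelicGroupData.units K D).IsAutomorphicMeasure μ] :
    ((AdelicGroupData.units K D).rightRegular μ).IsDiscretelyDecomposable := by
  obtain ⟨i₁, i₃⟩ := AdelicGroupData.units_locallyCompactSpace_secondCountableTopology K D
  haveI := i₁; haveI := i₃
  haveI : CompactSpace (AdelicGroupData.units K D).automorphicQuotient :=
    AdelicGroupData.compactSpace_automorphicQuotient_units_holds K D hdiv
  exact (AdelicGroupData.units K D).isDiscretelyDecomposable_rightRegular_of_locallyCompactSpace μ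

/-- Equivalently, **`L²_disc = L²` for `D^×`** (`D` division). [cite: DeitmarEchterhoff2014, Thm. 9.2.2] -/
theorem AdelicGroupData.discreteSpectrum_eq_top_units
    (hdiv : ∀ x : D, x ≠ 0 → IsUnit x) (μ : Measure (AdelicGroupData.units K D).automorphicQuotient)
    [(AdelicGroupData.units K D).IsAutomorphicMeasure μ] :
    (AdelicGroupData.units K D).discreteSpectrum μ = ⊤ :=
  AdelicGroupData.isDiscretelyDecomposable_rightRegular_units K D hdiv μ

/-- **Finite multiplicities for `D^×`** (Gelbart (1975), §10: `L²(G_ℚ Z_∞⁺ \\ G_𝔸) = ⊕ m(π) π` with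
`m(π) < ∞`; Deitmar–Echterhoff Thm. 9.2.2, second clause; Gelfand–Graev–Piatetski-Shapiro).
For a division quaternion algebra `D` and an automorphic measure `μ`, every non-zero closed
subrepresentation `W₀` of `L²(D_𝔸ˣ ⧸ ℝ_{>0} Dˣ)` — in particular every automorphic representation
of `D^×` — has finite multiplicity in `L²`: the operators `R(f)`, `f ∈ C_c(D_𝔸ˣ)`, are compact
(`isCompactOperator_integratedOperator_rightRegular`), commute with the commutant
(`comp_integratedOperator_eq_integratedOperator_comp`) and do not all kill `W₀` (Dirac
functions), so `IsUnitary.multiplicity_lt_top_of_isCompactOperator` applies.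
[cite: DeitmarEchterhoff2014, Thm. 9.2.2] -/
theorem AdelicGroupData.multiplicity_lt_top_units
    (hdiv : ∀ x : D, x ≠ 0 → IsUnit x) (μ : Measure (AdelicGroupData.units K D).automorphicQuotient)
    [(AdelicGroupData.units K D).IsAutomorphicMeasure μ]
    (W₀ : ContRepresentation.ClosedSubrep ((AdelicGroupData.units K D).rightRegular μ))
    (hW₀ : W₀ ≠ ⊥) :
    ((AdelicGroupData.units K D).rightRegular μ).multiplicity W₀.toContRep < ⊤ := by
  obtain ⟨i₁, i₃⟩ := AdelicGroupData.units_locallyCompactSpace_secondCountableTopology K D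
  haveI := i₁; haveI := i₃
  haveI : CompactSpace (AdelicGroupData.units K D).automorphicQuotient :=
    AdelicGroupData.compactSpace_automorphicQuotient_units_holds K D hdiv
  letI : MeasurableSpace (AdelicGroupData.units K D).Adelic := borel _
  haveI : BorelSpace (AdelicGroupData.units K D).Adelic := ⟨rfl⟩
  set ν : Measure (AdelicGroupData.units K D).Adelic := Measure.haar with hν
  have hu := (AdelicGroupData.units K D).isUnitary_rightRegular μ
  have hc := (AdelicGroupData.units K D).isStronglyContinuous_rightRegular_holds μ
  refine hu.multiplicity_lt_top_of_isCompactOperator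
    {T | ∃ f : C_c((AdelicGroupData.units K D).Adelic, ℂ),
      T = ((AdelicGroupData.units K D).rightRegular μ).integratedOperator hu hc ν f} ?_ ?_ W₀ ?_
  · rintro T ⟨f, rfl⟩
    exact (AdelicGroupData.units K D).isCompactOperator_integratedOperator_rightRegular μ ν f
  · rintro T ⟨f, rfl⟩ U hUc
    exact ContRepresentation.comp_integratedOperator_eq_integratedOperator_comp _ hu hc ν f U hUc
  · obtain ⟨v, hvW, hv0⟩ : ∃ v ∈ W₀, v ≠ 0 := by
      by_contra! hall
      exact hW₀ (ContRepresentation.ClosedSubrep.ext fun w => by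
        rw [ContRepresentation.ClosedSubrep.mem_bot]
        exact ⟨hall w, fun h => h ▸ W₀.toSubmodule.zero_mem⟩)
    obtain ⟨U, hU, hUf⟩ :=
      ContRepresentation.exists_nhds_integratedOperator_apply_ne_zero hu hc ν hv0
    obtain ⟨f, hfre, hfU, hfpos⟩ := exists_dirac_function' ν hU
    exact ⟨_, ⟨f, rfl⟩, v, hvW, hUf f hfre hfU hfpos⟩

end Literature.NumberTheory.Automorphic
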